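import Mathlib.Analysis.SpecialFunctions.Complex.Circle
import Mathlib.GroupTheory.QuotientGroup.Basic
import Literature.IUT.LogThetaLattice.BiCores
import HarnessLib

/-!
# [IUTchIII] Def 1.1 (v)(vi), Thm 1.5 (iii), (iv): the printed COMPATIBILITY clauses (companion to `BiCores.lean`)

Mochizuki, *Inter-universal Teichmüller Theory III*, kurims manuscript (May 2020), §1
[cite: Mochizuki2012, III Def 1.1 (v)(vi) pp.27–28; Thm 1.5 (iii), (iv) pp.49–50] (D-0012 claim key, status
disputed; typed over the interface `BiCoricData` of `BiCores.lean`; nothing is asserted beyond what is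
proved from that interface; the one datum the interface lacks is a small named interface).

This file answers the second-pass audits of `BiCores.lean` v3 (p406839): abc-iut-L6-d3 F1/F2/A1–A3
(2026-08-25T20:35Z) and referee lane O finding O1-F3 (`ref/REFEREE-PASS-O1.md`). `BiCores.lean` is
landed and append-frozen; every repair is a NEW declaration here (no field of `BiCoricData` changes).

Printed text read on the page and what is typed for it.
* Def 1.1 (v) p.27–28 (`v ∈ V̲^{arc}`): the functorial algorithm for `log(†F^⊢_v)`, `I_{†F^⊢_v}` "only makes
  use of the unit portion of this split Frobenioid, together with a pointed universal covering of this
  unit portion. Moreover … one may in fact regard this functorial algorithm as an algorithm that only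
  makes use of the quotient of this unit portion by its `N`-torsion subgroup, for `N ∈ ℕ_{≥1}`, together
  with a pointed universal covering of this quotient." CONCRETE CONTENT typed and proved for the unit
  portion `S¹ = 𝒪^×_ℂ`: the `N`-th power map `S¹ → S¹` is a quotient covering map with kernel the
  `N`-torsion subgroup (Mathlib), hence `S¹/S¹[N] ≅ S¹` as groups, and the pointed universal covering
  `exp : ℝ → S¹` of `S¹` covers the quotient through `t ↦ N·t` (`def11v_*`).
* Def 1.1 (vi) p.28: "`I_{†F^{⊢×μ}} := {I_{†F^{⊢×μ}_v}}_{v∈V̲} ⊆ log(†F^{⊢×μ}) := {log(†F^{⊢×μ}_v)}_{v∈V̲}` …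
  constructed solely from the `F^{⊢×μ}`-prime-strip `†F^{⊢×μ}`" = the object `B.fxmShell.obj X` of the
  interface (`fxmShellOf`), transported along isomorphisms of `F^{⊢×μ}`-prime-strips ONLY (`fxmShellOf_iso`).
* Thm 1.5 (iii) p.50, final display (d3-F2): "Kummer isomorphisms `^{n,m}F^{⊢×μ}_△ ⥲ F^{⊢×μ}_△(^{n,m}D^⊢_△)`
  which are compatible with the poly-isomorphisms of (ii), as well as with the `×μ`-Kummer structures at
  the `v ∈ V̲^{non}` of the various `F^{⊢×μ}`-prime-strips involved [cf. [IUTchII], Definition 4.9, (vi),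
  (vii)]; a similar compatibility holds for `v ∈ V̲^{arc}`". TYPED: (a) the Kummer isomorphisms carry the
  full poly-isomorphism `^{n,m}F^{⊢×μ}_△ ⥲ ^{n′,m}F^{⊢×μ}_△` of (ii) [`HodgeTheaterLogLink`:
  `horizontal_inducedFxm_full`] onto the full poly-isomorphism of the bi-coric strips
  (`kummerTransport_image_full`, PROVED), which contains the `D^⊢`-induced poly-isomorphism of the second
  line of the fifth display of (iii) (`horizontalPolyIso_subset_kummerTransport`, PROVED) and maps onto the
  FULL poly-isomorphism `^{n,m}D^⊢_△ ⥲ ^{n′,m}D^⊢_△` of `D^⊢`-prime-strips [IUTchII, Cor 4.10 (iv)]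
  (`kummerTransport_dv_full`, PROVED from `fxmOfDv_dv`); (b) the `×μ`-Kummer-structure clause is CARRIED
  BY THE TYPING: `kummerAt X` is an isomorphism IN the category `S.Fxm` of `F^{⊢×μ}`-prime-strips, whose
  isomorphisms are by definition compatible with the `×μ`-Kummer structures [IUTchII, Def 4.9 (vi), (vii);
  owner abc-iut-L6-t2, `KummerPrimeStrips`, TODO-merge] — said in the section docstring, no extra decl.
* Thm 1.5 (iv) p.50 (ref-o O1-F3): (1) first display, SECOND line
  `{I_{F^{⊢×μ}_△(^{n,m}D^⊢_△)} ⊆ …} ⥲ {I_{F^{⊢×μ}_△(^{n′,m′}D^⊢_△)} ⊆ …}` = `biCoricFxmShellPolyIso`; (2) "compatible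
  with the natural poly-isomorphisms … of Proposition 1.2, (viii)" = the square of poly-isomorphisms
  COMMUTES (`thm15iv_compat_viii`, PROVED from `monoFxm_map` and the naturality of
  `D^⊢(F^{⊢×μ}_△(D^⊢)) ≅ D^⊢`, constituent-wise `thm15iv_compat_viii_single`); (3) the "holomorphic" pair
  `I_{^{n,m}F_△} ⊆ log(^{n,m}F_△)` ("by means of a slight abuse of notation, since no `F`-prime-strip
  "`^{n,m}F_△`" has been defined!") and the SECOND arrow `{I_{^{n,m}F^{⊢×μ}_△}} ⥲ {I_{^{n,m}F_△}}` of the last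
  display are DATA the interface `BiCoricData` does not contain: typed as the small interface
  `HolDeltaShellData B` (functor `S.HT ⥤ B.Sh` + a nonempty poly-isomorphism "[cf. … Proposition 1.2,
  (viii)]"), with the whole last display `finalDisplayAt` and its non-emptiness; (4) "the first "`⥲`" may
  be regarded as being induced by the Kummer isomorphisms of (iii) and is compatible with the
  poly-isomorphisms induced by the poly-isomorphisms of (ii)" = `shellKummerAt_compat_ii` (PROVED: the
  square with the full poly-isomorphism of (ii) pushed through `fxmShell` commutes).
* Thm 1.5 (v) (d3-F1, "induce AN isomorphism"): see the sibling file `BiCoresRealified.lean`.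

Notes on `BiCores.lean` (advisories, no defect; recorded here because that file is frozen).
d3-A1: `BiCoricData.monoFxm` is typed as a nonempty transport-stable poly-isomorphism; print pins it to
exactly ONE `Ism`-orbit at `v ∈ V̲^{non}` (a torsor under `Ism` of [IUTchII] Ex 1.8 (iv) / Def 4.9 (i),
(vii)) and a `{±1}`-orbit at `v ∈ V̲^{arc}` (Prop 1.2 (vii)) — "one orbit" becomes checkable at the merge
with abc-iut-L6-t2's `KummerStructures.isometryGroup` (TODO-merge:abc-iut-L6-t2). d3-A2:
`BiCoricData.biCoricPolyIso H p q` with `q.1 = p.1` (a purely vertical move) still post-composes the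
`Aut(D^⊢_△)`-induced isomorphisms (`horizontalPolyIso` between equal objects), i.e. it is the maximal
bi-coric class also where print composes vertical arrows only; the purely vertical poly-isomorphism is
`BiCoricData.verticalPolyIso` (contained in it, `verticalPolyIso_subset`).
Deliberately NOT typed here: Thm 1.5 (v) (sibling file `BiCoresRealified.lean`); Rmk 1.5.x as listed in `BiCores.lean`.
-/

namespace Literature.IUT.LogThetaLattice

open CategoryTheory
open Literature.IUT.HodgeTheaters

universe u

/-! ### Def 1.1 (v): at `v ∈ V̲^{arc}` only the units modulo `N`-torsion and a pointed universal covering are used -/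

section Def11v

open Circle

/-- **IUTchIII:Def1.1(v)** (kurims pp.27–28) "this functorial algorithm may, in fact, be regarded as an
algorithm that only makes use of the quotient of this unit portion by its `N`-torsion subgroup, for
`N ∈ ℕ_{≥1}`, together with a pointed universal covering of this quotient": for the unit portion
`S¹ = 𝒪_ℂ^×` of the complex archimedean field, the `N`-th power map `S¹ → S¹` IS the quotient by the
`N`-torsion subgroup `S¹[N] = Ker(z ↦ z^N)` — a quotient covering map (Mathlib
`Circle.isQuotientCoveringMap_npow`). [claim: Mochizuki2012, status: disputed] -/
theorem def11v_npow_isQuotientCoveringMap (N : ℕ) [NeZero N] :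
    IsQuotientCoveringMap (fun z : Circle => z ^ N) (powMonoidHom (α := Circle) N).ker :=
  Circle.isQuotientCoveringMap_npow N

/-- **IUTchIII:Def1.1(v)** (kurims pp.27–28) the `N`-th power map of the unit portion `S¹` is surjective
(every unit has an `N`-th root), so passing to the quotient by the `N`-torsion subgroup loses nothing.
[claim: Mochizuki2012, status: disputed] -/
theorem def11v_npow_surjective (N : ℕ) [NeZero N] :
    Function.Surjective (powMonoidHom (α := Circle) N) := by
  intro z
  refine ⟨Circle.exp (Complex.arg (z : ℂ) / N), ?_⟩
  have hN : (N : ℝ) ≠ 0 := by exact_mod_cast NeZero.ne N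
  rw [powMonoidHom_apply, ← Circle.exp_nsmul, nsmul_eq_mul, mul_div_cancel₀ _ hN, Circle.exp_arg]

/-- **IUTchIII:Def1.1(v)** (kurims pp.27–28) "the quotient of this unit portion by its `N`-torsion
subgroup": `S¹ / S¹[N] ≅ S¹` canonically (first isomorphism theorem for `z ↦ z^N`), i.e. the quotient is
again a copy of the unit portion. [claim: Mochizuki2012, status: disputed] -/
noncomputable def def11v_unitsModTorsionEquiv (N : ℕ) [NeZero N] :
    Circle ⧸ (powMonoidHom (α := Circle) N).ker ≃* Circle :=
  QuotientGroup.quotientKerEquivOfSurjective _ (def11v_npow_surjective N)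

/-- **IUTchIII:Def1.1(v)** (kurims pp.27–28) "together with a pointed universal covering of this
quotient": the pointed (`exp 0 = 1`) universal covering `exp : ℝ → S¹` of the unit portion is a covering
map, and it covers the quotient `S¹/S¹[N] ≅ S¹` through `t ↦ N·t`: `exp(N·t) = exp(t)^N`.
[claim: Mochizuki2012, status: disputed] -/
theorem def11v_pointedUniversalCovering (N : ℕ) :
    IsCoveringMap Circle.exp ∧ Circle.exp 0 = 1 ∧ ∀ t : ℝ, Circle.exp (N * t) = Circle.exp t ^ N :=
  ⟨Circle.isCoveringMap_exp, Circle.exp_zero, fun t => by rw [← nsmul_eq_mul, Circle.exp_nsmul]⟩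

end Def11v

/-! ### Two membership lemmas for poly-isomorphisms (supplement to `HodgeTheaters/PolyIsoFunctoriality.lean`,
same author; declared by absolute name so that no second `PolyIso` API file is needed) -/

section PolyIsoLemmas

variable {C : Type*} [Category C] {A A' B' D : C}

/-- **IUTchI:§0** (kurims p.33) membership in `{a} ∘ Q` ("the composite … `{g_j ∘ f_i}`").
[claim: Mochizuki2012, status: disputed] -/
theorem _root_.Literature.IUT.HodgeTheaters.PolyIso.mem_single_comp {a : A ≅ A'} {Q : PolyIso A' D}
    {h : A ≅ D} : h ∈ (PolyIso.single a).comp Q ↔ ∃ q ∈ Q, a ≪≫ q = h := by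
  rw [PolyIso.mem_comp]
  constructor
  · rintro ⟨f, hf, q, hq, rfl⟩
    rw [PolyIso.mem_single] at hf
    exact ⟨q, hq, by rw [hf]⟩
  · rintro ⟨q, hq, rfl⟩
    exact ⟨a, PolyIso.mem_single.mpr rfl, q, hq, rfl⟩

/-- **IUTchI:§0** (kurims p.33) membership in `P ∘ {b}`. [claim: Mochizuki2012, status: disputed] -/
theorem _root_.Literature.IUT.HodgeTheaters.PolyIso.mem_comp_single {P : PolyIso A B'} {b : B' ≅ D}
    {h : A ≅ D} : h ∈ P.comp (PolyIso.single b) ↔ ∃ p ∈ P, p ≪≫ b = h := by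
  rw [PolyIso.mem_comp]
  constructor
  · rintro ⟨p, hp, g, hg, rfl⟩
    rw [PolyIso.mem_single] at hg
    exact ⟨p, hp, by rw [hg]⟩
  · rintro ⟨p, hp, rfl⟩
    exact ⟨p, hp, b, PolyIso.mem_single.mpr rfl, rfl⟩

end PolyIsoLemmas

namespace BiCoricData

variable {S : StripFrame.{u}} (B : BiCoricData S)

/-! ### Def 1.1 (vi): the collection `I_{†F^{⊢×μ}} ⊆ log(†F^{⊢×μ})` as an object built from `†F^{⊢×μ}` alone -/

/-- **IUTchIII:Def1.1(vi)** (kurims p.28) "`I_{†F^{⊢×μ}} := {I_{†F^{⊢×μ}_v}}_{v∈V̲} ⊆ log(†F^{⊢×μ}) :=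
{log(†F^{⊢×μ}_v)}_{v∈V̲}` … the resulting collections of data constructed solely from the
`F^{⊢×μ}`-prime-strip `†F^{⊢×μ}` [i.e., which we do not regard as objects constructed from `†F`!]": the
object of `B.Sh` attached to the `F^{⊢×μ}`-prime-strip `X` by the interface functor `fxmShell` (the
collection over `v ∈ V̲` of the local pairs of Def 1.1 (iv) [`v ∈ V̲^{non}`] and (v) [`v ∈ V̲^{arc}`]).
[claim: Mochizuki2012, status: disputed] -/
abbrev fxmShellOf (X : S.Fxm) : B.Sh := B.fxmShell.obj X

/-- **IUTchIII:Def1.1(vi)** (kurims p.28) "constructed solely from the `F^{⊢×μ}`-prime-strip": the pair is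
transported along isomorphisms OF `F^{⊢×μ}`-PRIME-STRIPS (functorial algorithm in `†F^{⊢×μ}`), no
`F`-prime-strip being involved. [claim: Mochizuki2012, status: disputed] -/
def fxmShellOf_iso {X Y : S.Fxm} (f : X ≅ Y) : B.fxmShellOf X ≅ B.fxmShellOf Y := B.fxmShell.mapIso f

/-- **IUTchIII:Def1.1(vi)** (kurims p.28) the transport is functorial: composites go to composites.
[claim: Mochizuki2012, status: disputed] -/
theorem fxmShellOf_iso_trans {X Y Z : S.Fxm} (f : X ≅ Y) (g : Y ≅ Z) :
    B.fxmShellOf_iso (f ≪≫ g) = B.fxmShellOf_iso f ≪≫ B.fxmShellOf_iso g :=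
  B.fxmShell.mapIso_trans f g

/-! ### Thm 1.5 (iii), final display: the compatibility clauses of the Kummer isomorphisms (d3-F2)

The clause "compatible … with the `×μ`-Kummer structures at the `v ∈ V̲^{non}` of the various
`F^{⊢×μ}`-prime-strips involved [cf. [IUTchII], Definition 4.9, (vi), (vii)]; a similar compatibility holds
for `v ∈ V̲^{arc}`" (p.50) is CARRIED BY THE TYPING of `BiCores.lean`: `BiCoricData.kummerAt X` is an
isomorphism IN the category `S.Fxm` of `F^{⊢×μ}`-prime-strips, whose morphisms respect the `×μ`-Kummer
structures by definition ([IUTchII] Def 4.9 (vii); owner abc-iut-L6-t2, `KummerPrimeStrips`, TODO-merge);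
no separate declaration. -/

/-- **IUTchIII:Thm1.5(iii)** (kurims p.50) "compatible with the poly-isomorphisms of (ii)": transporting the FULL
poly-isomorphism `^{n,m}F^{⊢×μ}_△ ⥲ ^{n′,m}F^{⊢×μ}_△` of Thm 1.5 (ii) along the Kummer isomorphisms at both ends
yields the FULL poly-isomorphism of the bi-coric strips `F^{⊢×μ}_△(^{n,m}D^⊢_△) ⥲ F^{⊢×μ}_△(^{n′,m}D^⊢_△)`.
[claim: Mochizuki2012, status: disputed] -/
theorem kummerTransport_image_full (X Y : S.HT) :
    B.kummerTransport '' (PolyIso.full (B.fxmDeltaHT.obj X) (B.fxmDeltaHT.obj Y)) =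
      PolyIso.full (B.fxmDeltaOf (S.htToD.obj X)) (B.fxmDeltaOf (S.htToD.obj Y)) := by
  ext e
  simp only [Set.mem_image, PolyIso.mem_full, true_and, iff_true]
  refine ⟨B.kummerAt X ≪≫ e ≪≫ (B.kummerAt Y).symm, ?_⟩
  simp only [kummerTransport, Iso.trans_assoc, Iso.symm_self_id, Iso.trans_refl, Iso.symm_self_id_assoc]

/-- **IUTchIII:Thm1.5(iii)** (kurims p.50) hence the `D^⊢`-induced poly-isomorphism of the second line of the fifth
display of (iii) ("not full") lies inside the Kummer transport of the poly-isomorphism of (ii).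
[claim: Mochizuki2012, status: disputed] -/
theorem horizontalPolyIso_subset_kummerTransport (X Y : S.HT) :
    B.horizontalPolyIso (S.htToD.obj X) (S.htToD.obj Y) ⊆
      B.kummerTransport '' (PolyIso.full (B.fxmDeltaHT.obj X) (B.fxmDeltaHT.obj Y)) := by
  rw [kummerTransport_image_full]
  exact Set.subset_univ _

/-- **IUTchIII:Thm1.5(iv)** (kurims p.50) the isomorphism of `D^⊢`-prime-strips `D^⊢ ⥲ D'^⊢` UNDERLYING an
isomorphism `f : F^{⊢×μ}_△(D^⊢) ⥲ F^{⊢×μ}_△(D'^⊢)` of bi-coric strips, via `D^⊢(F^{⊢×μ}_△(D^⊢)) ≅ D^⊢` (`dvIso`).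
[claim: Mochizuki2012, status: disputed] -/
def dvConj {X Y : S.Dv} (f : B.fxmOfDv.obj X ≅ B.fxmOfDv.obj Y) : X ≅ Y :=
  (B.dvIso X).symm ≪≫ S.FxmToDv.mapIso f ≪≫ B.dvIso Y

/-- **IUTchIII:Thm1.5(iv)** (kurims p.50) naturality of `D^⊢(F^{⊢×μ}_△(D^⊢)) ≅ D^⊢`: the `D^⊢`-isomorphism underlying
`F^{⊢×μ}_△(d)` is `d`. [claim: Mochizuki2012, status: disputed] -/
theorem dvConj_mapIso {X Y : S.Dv} (d : X ≅ Y) : B.dvConj (B.fxmOfDv.mapIso d) = d := by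
  ext
  simp only [dvConj, dvIso, Iso.trans_hom, Iso.symm_hom, Functor.mapIso_hom]
  exact NatIso.naturality_1 B.fxmOfDv_dv d.hom

/-- **IUTchIII:Thm1.5(iii)** (kurims p.50) "compatible with the poly-isomorphisms of (ii)" at the level of
`D^⊢`-prime-strips: the Kummer transport of the FULL poly-isomorphism of (ii) induces, on underlying
`D^⊢`-prime-strips, the FULL poly-isomorphism `^{n,m}D^⊢_△ ⥲ ^{n′,m}D^⊢_△` [IUTchII, Cor 4.10 (iv): "this full
poly-isomorphism induces the full poly-isomorphism `†D^⊢_△ ⥲ ‡D^⊢_△`"]. [claim: Mochizuki2012, status: disputed] -/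
theorem kummerTransport_dv_full (X Y : S.HT) :
    B.dvConj '' (B.kummerTransport '' (PolyIso.full (B.fxmDeltaHT.obj X) (B.fxmDeltaHT.obj Y))) =
      PolyIso.full (B.dvDeltaOf (S.htToD.obj X)) (B.dvDeltaOf (S.htToD.obj Y)) := by
  rw [kummerTransport_image_full]
  ext d
  simp only [Set.mem_image, PolyIso.mem_full, true_and, iff_true]
  exact ⟨B.fxmOfDv.mapIso d, B.dvConj_mapIso d⟩

/-! ### Thm 1.5 (iv): the second line of the first display and the compatibility with Prop 1.2 (viii) (ref-o O1-F3) -/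

/-- **IUTchIII:Thm1.5(iv)** (kurims p.50) first display, SECOND line: the poly-isomorphisms
`{I_{F^{⊢×μ}_△(^{n,m}D^⊢_△)} ⊆ log(F^{⊢×μ}_△(^{n,m}D^⊢_△))} ⥲ {I_{F^{⊢×μ}_△(^{n′,m′}D^⊢_△)} ⊆ …}` induced [through the functorial
algorithm `fxmShell` of Def 1.1 (vi)] by the bi-coricity poly-isomorphisms of `F^{⊢×μ}`-prime-strips of (iii)
— all of which are of `D^⊢`-induced type (`biCoricPolyIso_subset`), whence typed on that class.
[claim: Mochizuki2012, status: disputed] -/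
def biCoricFxmShellPolyIso (H H' : S.DHT) :
    PolyIso (B.fxmShell.obj (B.fxmDeltaOf H)) (B.fxmShell.obj (B.fxmDeltaOf H')) :=
  (B.horizontalPolyIso H H').map B.fxmShell

/-- **IUTchIII:Thm1.5(iv)** (kurims p.50) for a `ℤ × ℤ`-family of Hodge theaters, the image of the composite
bi-coric poly-isomorphism `biCoricPolyIso` lies in `biCoricFxmShellPolyIso`. [claim: Mochizuki2012, status: disputed] -/
theorem biCoricPolyIso_map_fxmShell_subset (H : ℤ × ℤ → S.HT) (p q : ℤ × ℤ) :
    (B.biCoricPolyIso H p q).map B.fxmShell ⊆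
      B.biCoricFxmShellPolyIso (S.htToD.obj (H p)) (S.htToD.obj (H q)) :=
  Set.image_mono (B.biCoricPolyIso_subset H p q)

/-- **IUTchIII:Thm1.5(iv)** (kurims p.50) transport of the natural `Ism`-orbit of Prop 1.2 (viii) along an
ARBITRARY isomorphism `f` of bi-coric strips (from `monoFxm_map`): post-composing the orbit at `D^⊢` with
`I(f)` gives the orbit at `D'^⊢` pre-composed with `I(d_f)`, `d_f` the underlying `D^⊢`-isomorphism — one
inclusion. [claim: Mochizuki2012, status: disputed] -/
theorem exists_of_mem_monoShellOfDeltaAt {X Y : S.Dv} (f : B.fxmOfDv.obj X ≅ B.fxmOfDv.obj Y)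
    {a : B.monoShell.obj X ≅ B.fxmShell.obj (B.fxmOfDv.obj X)} (ha : a ∈ B.monoShellOfDeltaAt X) :
    ∃ b ∈ B.monoShellOfDeltaAt Y,
      a ≪≫ B.fxmShell.mapIso f = B.monoShell.mapIso (B.dvConj f) ≪≫ b := by
  obtain ⟨e₀, he₀, rfl⟩ := PolyIso.mem_single_comp.mp ha
  refine ⟨(B.monoShell.mapIso (B.dvIso Y)).symm ≪≫
      ((B.monoShell.mapIso (S.FxmToDv.mapIso f)).symm ≪≫ e₀ ≪≫ B.fxmShell.mapIso f),
    PolyIso.mem_single_comp.mpr ⟨_, B.monoFxm_map f e₀ he₀, rfl⟩, ?_⟩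
  simp only [dvConj, Functor.mapIso_trans, Functor.mapIso_symm, Iso.trans_assoc, Iso.self_symm_id_assoc]

/-- **IUTchIII:Thm1.5(iv)** (kurims p.50) the converse inclusion (from `monoFxm_map` applied to `f⁻¹`).
[claim: Mochizuki2012, status: disputed] -/
theorem exists_of_mem_monoShellOfDeltaAt' {X Y : S.Dv} (f : B.fxmOfDv.obj X ≅ B.fxmOfDv.obj Y)
    {b : B.monoShell.obj Y ≅ B.fxmShell.obj (B.fxmOfDv.obj Y)} (hb : b ∈ B.monoShellOfDeltaAt Y) :
    ∃ a ∈ B.monoShellOfDeltaAt X,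
      B.monoShell.mapIso (B.dvConj f) ≪≫ b = a ≪≫ B.fxmShell.mapIso f := by
  obtain ⟨e₁, he₁, rfl⟩ := PolyIso.mem_single_comp.mp hb
  refine ⟨(B.monoShell.mapIso (B.dvIso X)).symm ≪≫
      ((B.monoShell.mapIso (S.FxmToDv.mapIso f.symm)).symm ≪≫ e₁ ≪≫ B.fxmShell.mapIso f.symm),
    PolyIso.mem_single_comp.mpr ⟨_, B.monoFxm_map f.symm e₁ he₁, rfl⟩, ?_⟩
  simp only [dvConj, Functor.mapIso_trans, Functor.mapIso_symm, Iso.symm_symm_eq, Iso.trans_assoc,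
    Iso.self_symm_id_assoc, Iso.symm_self_id, Iso.trans_refl]

/-- **IUTchIII:Thm1.5(iv)** (kurims p.50) "compatible with the natural poly-isomorphisms … of Proposition 1.2,
(viii)", ONE CONSTITUENT `d : D^⊢ ⥲ D'^⊢` at a time: the square of poly-isomorphisms
`{I_{D^⊢}} ⥲ {I_{F^{⊢×μ}_△(D^⊢)}}` (Prop 1.2 (viii)) / `I(d)` / `I(F^{⊢×μ}_△(d))` / `{I_{D'^⊢}} ⥲ {I_{F^{⊢×μ}_△(D'^⊢)}}` COMMUTES
(as sets of composites). [claim: Mochizuki2012, status: disputed] -/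
theorem thm15iv_compat_viii_single {X Y : S.Dv} (d : X ≅ Y) :
    (B.monoShellOfDeltaAt X).comp (PolyIso.single (B.fxmShell.mapIso (B.fxmOfDv.mapIso d))) =
      (PolyIso.single (B.monoShell.mapIso d)).comp (B.monoShellOfDeltaAt Y) := by
  ext e
  rw [PolyIso.mem_comp_single, PolyIso.mem_single_comp]
  constructor
  · rintro ⟨a, ha, rfl⟩
    obtain ⟨b, hb, h⟩ := B.exists_of_mem_monoShellOfDeltaAt (B.fxmOfDv.mapIso d) ha
    rw [B.dvConj_mapIso] at h
    exact ⟨b, hb, h.symm⟩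
  · rintro ⟨b, hb, rfl⟩
    obtain ⟨a, ha, h⟩ := B.exists_of_mem_monoShellOfDeltaAt' (B.fxmOfDv.mapIso d) hb
    rw [B.dvConj_mapIso] at h
    exact ⟨a, ha, h.symm⟩

/-- **IUTchIII:Thm1.5(iv)** (kurims p.50) "poly-isomorphisms `{I_{^{n,m}D^⊢_△} ⊆ …} ⥲ {I_{^{n′,m′}D^⊢_△} ⊆ …}`,
`{I_{F^{⊢×μ}_△(^{n,m}D^⊢_△)} ⊆ …} ⥲ {I_{F^{⊢×μ}_△(^{n′,m′}D^⊢_△)} ⊆ …}` … that are compatible with the natural poly-isomorphisms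
`{I_{^{n,m}D^⊢_△} ⊆ …} ⥲ {I_{F^{⊢×μ}_△(^{n,m}D^⊢_△)} ⊆ …}` of Proposition 1.2, (viii)": the square of poly-isomorphisms
COMMUTES. PROVED from the interface (`monoFxm_map`, naturality of `fxmOfDv_dv`).
[claim: Mochizuki2012, status: disputed] -/
theorem thm15iv_compat_viii (H H' : S.DHT) :
    (B.biCoricShellPolyIso H H').comp (B.monoShellOfDeltaAt (B.dvDeltaOf H')) =
      (B.monoShellOfDeltaAt (B.dvDeltaOf H)).comp (B.biCoricFxmShellPolyIso H H') := by
  ext e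
  simp only [biCoricShellPolyIso, biCoricFxmShellPolyIso, horizontalPolyIso, PolyIso.mem_comp,
    PolyIso.mem_map, PolyIso.mem_full, true_and]
  constructor
  · rintro ⟨_, ⟨d, rfl⟩, b, hb, rfl⟩
    obtain ⟨a, ha, h⟩ := B.exists_of_mem_monoShellOfDeltaAt' (B.fxmOfDv.mapIso d) hb
    rw [B.dvConj_mapIso] at h
    exact ⟨a, ha, _, ⟨_, ⟨d, rfl⟩, rfl⟩, h.symm⟩
  · rintro ⟨a, ha, _, ⟨_, ⟨d, rfl⟩, rfl⟩, rfl⟩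
    obtain ⟨b, hb, h⟩ := B.exists_of_mem_monoShellOfDeltaAt (B.fxmOfDv.mapIso d) ha
    rw [B.dvConj_mapIso] at h
    exact ⟨_, ⟨d, rfl⟩, b, hb, h.symm⟩

/-- **IUTchIII:Thm1.5(iv)** (kurims p.50) last sentence: "the first "`⥲`" [`{I_{^{n,m}D^⊢_△}} ⥲ {I_{^{n,m}F^{⊢×μ}_△}}`,
`shellKummerAt`] may be regarded as being induced by the Kummer isomorphisms of (iii) and is compatible with
the poly-isomorphisms induced by the poly-isomorphisms of (ii)": the square formed by the `D^⊢`-induced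
poly-isomorphism `{I_{^{n,m}D^⊢_△}} ⥲ {I_{^{n′,m}D^⊢_△}}`, the two first arrows, and the image under `I_{(−)}` of the FULL
poly-isomorphism `^{n,m}F^{⊢×μ}_△ ⥲ ^{n′,m}F^{⊢×μ}_△` of (ii) COMMUTES. PROVED. [claim: Mochizuki2012, status: disputed] -/
theorem shellKummerAt_compat_ii (X Y : S.HT) :
    (B.biCoricShellPolyIso (S.htToD.obj X) (S.htToD.obj Y)).comp (B.shellKummerAt Y) =
      (B.shellKummerAt X).comp
        ((PolyIso.full (B.fxmDeltaHT.obj X) (B.fxmDeltaHT.obj Y)).map B.fxmShell) := by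
  ext e
  simp only [biCoricShellPolyIso, shellKummerAt, PolyIso.mem_comp, PolyIso.mem_map, PolyIso.mem_full,
    PolyIso.mem_single, true_and, exists_eq_left]
  constructor
  · rintro ⟨_, ⟨d, rfl⟩, _, ⟨b, hb, rfl⟩, rfl⟩
    obtain ⟨a, ha, h⟩ := B.exists_of_mem_monoShellOfDeltaAt' (B.fxmOfDv.mapIso d) hb
    rw [B.dvConj_mapIso] at h
    refine ⟨_, ⟨a, ha, rfl⟩, _, ⟨B.kummerAt X ≪≫ B.fxmOfDv.mapIso d ≪≫ (B.kummerAt Y).symm, rfl⟩, ?_⟩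
    rw [← Iso.trans_assoc (B.monoShell.mapIso d), h]
    simp only [Functor.mapIso_trans, Functor.mapIso_symm, Iso.trans_assoc, Iso.symm_self_id_assoc]
  · rintro ⟨_, ⟨a, ha, rfl⟩, _, ⟨Φ, rfl⟩, rfl⟩
    obtain ⟨b, hb, h⟩ := B.exists_of_mem_monoShellOfDeltaAt (B.kummerTransport Φ) ha
    refine ⟨_, ⟨B.dvConj (B.kummerTransport Φ), rfl⟩, _, ⟨b, hb, rfl⟩, ?_⟩
    rw [← Iso.trans_assoc (B.monoShell.mapIso _), ← h]
    simp only [kummerTransport, Functor.mapIso_trans, Functor.mapIso_symm, Iso.trans_assoc,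
      Iso.self_symm_id, Iso.trans_refl]

/-! ### Thm 1.5 (iv), last display: the holomorphic pair `I_{^{n,m}F_△} ⊆ log(^{n,m}F_△)` and the second arrow -/

/-- **IUTchIII:Thm1.5(iv)** (kurims p.50) INTERFACE (data not contained in `BiCoricData`): "by applying the
constructions of Definition 1.1, (i), (ii), to the collections of data "`Ψ_cns(†F_≻)_0`" and "`Ψ_cns(†F_≻)_{⟨𝔽_l^⋇⟩}`"
used in [IUTchII], Corollary 4.10, (i), to construct `^{n,m}F^⊢_△` … one obtains a ["holomorphic"] log-shell,
together with an enveloping "`log(−)`" … which we denote by `I_{^{n,m}F_△} ⊆ log(^{n,m}F_△)` [by means of a slight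
abuse of notation, since no `F`-prime-strip "`^{n,m}F_△`" has been defined!]. Then one has natural
poly-isomorphisms `{I_{^{n,m}D^⊢_△} ⊆ …} ⥲ {I_{^{n,m}F^{⊢×μ}_△} ⊆ …} ⥲ {I_{^{n,m}F_△} ⊆ log(^{n,m}F_△)}` [cf. the
poly-isomorphisms obtained in Proposition 1.2, (viii)]" (owner of the constructions: this seat;
of `Ψ_cns(†F_≻)`: abc-iut-L6-t2, [IUTchII] Cor 4.10 (i), TODO-merge). [claim: Mochizuki2012, status: disputed] -/
structure HolDeltaShellData (B : BiCoricData S) where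
  /-- `^{n,m}HT ↦ {I_{^{n,m}F_△} ⊆ log(^{n,m}F_△)}`, functorially in the Hodge theater -/
  holShellDelta : S.HT ⥤ B.Sh
  /-- the SECOND arrow `{I_{^{n,m}F^{⊢×μ}_△} ⊆ log(^{n,m}F^{⊢×μ}_△)} ⥲ {I_{^{n,m}F_△} ⊆ log(^{n,m}F_△)}` of the last
  display "[cf. the poly-isomorphisms obtained in Proposition 1.2, (viii)]" (an isomorphism at
  `v ∈ V̲^{non}`, a `{±1}`-orbit at `v ∈ V̲^{arc}`, as there), one poly-isomorphism per Hodge theater -/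
  fxmToHol : ∀ X : S.HT, PolyIso (B.fxmShell.obj (B.fxmDeltaHT.obj X)) (holShellDelta.obj X)
  /-- it is nonempty -/
  fxmToHol_nonempty : ∀ X : S.HT, (fxmToHol X).Nonempty

namespace HolDeltaShellData

variable {B} (Δ : HolDeltaShellData B)

/-- **IUTchIII:Thm1.5(iv)** (kurims p.50) the whole last display
`{I_{^{n,m}D^⊢_△} ⊆ log(^{n,m}D^⊢_△)} ⥲ {I_{^{n,m}F^{⊢×μ}_△} ⊆ log(^{n,m}F^{⊢×μ}_△)} ⥲ {I_{^{n,m}F_△} ⊆ log(^{n,m}F_△)}` at `^{n,m}HT`: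
first arrow `shellKummerAt` ("induced by the Kummer isomorphisms of (iii)"), second arrow `fxmToHol`.
[claim: Mochizuki2012, status: disputed] -/
def finalDisplayAt (X : S.HT) :
    PolyIso (B.monoShell.obj (B.dvDeltaOf (S.htToD.obj X))) (Δ.holShellDelta.obj X) :=
  (B.shellKummerAt X).comp (Δ.fxmToHol X)

/-- **IUTchIII:Thm1.5(iv)** (kurims p.50) the composite poly-isomorphism of the last display is nonempty.
[claim: Mochizuki2012, status: disputed] -/
theorem finalDisplayAt_nonempty (X : S.HT) : (Δ.finalDisplayAt X).Nonempty := by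
  obtain ⟨a, ha⟩ := B.monoShellOfDeltaAt_nonempty (B.dvDeltaOf (S.htToD.obj X))
  obtain ⟨c, hc⟩ := Δ.fxmToHol_nonempty X
  exact ⟨_, _, ⟨a, ha, _, PolyIso.mem_single.mpr rfl, rfl⟩, c, hc, rfl⟩

end HolDeltaShellData

end BiCoricData

end Literature.IUT.LogThetaLattice
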